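import Summits.BirchSwinnertonDyer.BirchSwinnertonDyer.Theorems.SmallImageMuTransferMuTransferX9CoreStepOne
import HarnessLib

set_option autoImplicit false

-- the summit and its single problem are both named `BirchSwinnertonDyer` (registry layout D-0017)
set_option linter.dupNamespace false

/-!
# Defect levels for STEP 1 at `p`-level `k` (line `graded_euler_loss`, crux `KatoDivisibilityX9` =
# stmt-BirchSwinnertonDyer-20547, stub 1b `stub_kolyvaginPrimePkX9`): three pieces of algebra

Seat `bsd-line-k6-p4` (prover-bsd-line-k6-p4-g5-0, 5th LEAD on crux stmt-BirchSwinnertonDyer-20547; route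
`OneSidedTwistSqueezeX9`; host cell `bsd-f3-mu`).  THEOREMS ONLY, sorry-free, no definition, no named fact, nothing
asserted about any curve; `--supports stmt-BirchSwinnertonDyer-20547 --as helper` (service lemmas of the stub file
`…KatoDivisibilityX9StubKolyvaginPrimePkX9.lean`, split off for the 400-line limit).

* `unipotentPow_apply_of_forall_lt` — `(1+S)^a` does not move the coordinates `≤ c` of a vector vanishing below `c`
  (so `γ₀ − 1 = −S·U` on the dual twist has slots `c ↦ 0`, `c+1 ↦ −y_c` on `T^c𝒯_e`);
* `succ_le_index_of_forall_lt` — `[𝒯_J : T^c𝒯_J] = #M^c ≥ c + 1` (the DEFECT LEVEL `c` of a value group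
  `T^c𝒯_e` is bounded by its index);
* `convCoeff_add_eq_of_forall_lt` / `convCoeff_add_succ_eq_of_forall_lt` — READ-OFF: for `x ∈ T^{c₁}𝒯`,
  `y ∈ T^{c₂}𝒯` the convolution coefficients are `C_{c₁+c₂}(x,y) = e(x_{c₁}, y_{c₂})`,
  `C_{c₁+c₂+1}(x,y) = e(x_{c₁}, y_{c₂+1}) + e(x_{c₁+1}, y_{c₂})`;
* `index_valueSubgroup_dvd_relIndex` — for a cocycle `φ` with `φ(H) = X` and `H' ≤ H`:
  `[X : φ(H')] ∣ [H : H']` (`φ|_H` is a homomorphism onto `X`).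

HONEST LABEL: pure algebra; closes nothing; BSD is not proved by any of this; no summit statement is proved by this
seat.  References: B. Mazur, K. Rubin, Mem. AMS 799 (2004) §1.3, §5.3 [MazurRubin2004]; L. Washington, *Introduction
to Cyclotomic Fields* §13.1–13.2 [Washington1997]; J.-P. Serre, Invent. Math. 15 (1972) §2 [Serre1972].
-/

noncomputable section

open Function
open Literature.NumberTheory.GaloisRepresentations
open Literature.NumberTheory.EllipticCurves

namespace Summit.BirchSwinnertonDyer.BirchSwinnertonDyer.Theorems.OneSidedTwistSqueezeX9KatoDivisibilityX9DefectLevels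

/-! ## §1 Algebra: unipotent operators on vectors vanishing below a slot; the index of `T^c 𝒯_J`;
the two convolution coefficients of a pair with defects `(c₁, c₂)` -/

section Algebra

variable {M : Type*} [AddCommGroup M] {J : ℕ}

/-- `(1+S)^a` does not change the coordinates `≤ c` of a vector whose coordinates `< c` vanish
(`((1+T)^a y)_i = y_i + Σ_{j ≥ 1} C(a,j) y_{i−j}`). [cite: Washington1997, §13.1–§13.2] -/
theorem unipotentPow_apply_of_forall_lt (a : ℕ) {c : ℕ} (y : Fin J → M)
    (hy : ∀ j : Fin J, (j : ℕ) < c → y j = 0) (i : Fin J) (hi : (i : ℕ) ≤ c) :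
    unipotentPow M J a y i = y i := by
  induction a generalizing i with
  | zero => rw [unipotentPow, pow_zero, Module.End.one_apply]
  | succ a ih =>
    rw [ZpExtension.unipotentPow_succ_apply, Pi.add_apply, ih i hi, shiftEnd_apply]
    by_cases h0 : (i : ℕ) = 0
    · rw [dif_pos h0, add_zero]
    · rw [dif_neg h0, ih ⟨(i : ℕ) - 1, by omega⟩ (by simp only; omega),
        hy ⟨(i : ℕ) - 1, by omega⟩ (by simp only; omega), add_zero]

/-- **The index of `T^c 𝒯_J` is at least `c + 1`** (`c ≤ J`, `M` finite with at least two elements):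
`𝒯_J / T^c𝒯_J ≅ M^c` has `#M^c ≥ 2^c ≥ c + 1` elements. [folklore] -/
theorem succ_le_index_of_forall_lt [Finite M] [Nontrivial M] {c : ℕ} (hc : c ≤ J)
    (N : AddSubgroup (Fin J → M)) (hN : ∀ x, x ∈ N ↔ ∀ i : Fin J, (i : ℕ) < c → x i = 0) :
    c + 1 ≤ N.index := by
  let f : (Fin J → M) →+ (Fin c → M) := (LinearMap.funLeft ℤ M (Fin.castLE hc)).toAddMonoidHom
  have hf : Function.Surjective f :=
    LinearMap.funLeft_surjective_of_injective ℤ M _ (Fin.castLE_injective hc)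
  have hker : f.ker = N := by
    ext x
    rw [AddMonoidHom.mem_ker, hN]
    constructor
    · intro h i hi
      have := congrFun h ⟨i, hi⟩
      simpa [f, LinearMap.funLeft_apply] using this
    · intro h
      funext i
      simpa [f, LinearMap.funLeft_apply] using h (Fin.castLE hc i) (by simp)
  have hidx : N.index = Nat.card M ^ c := by
    rw [← hker, AddSubgroup.index_ker, AddMonoidHom.range_eq_top.mpr hf, AddSubgroup.card_top,
      Nat.card_fun, Nat.card_eq_fintype_card (α := Fin c), Fintype.card_fin]
  rw [hidx]
  calc c + 1 ≤ 2 ^ c := Nat.lt_pow_self (by norm_num)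
    _ ≤ Nat.card M ^ c := Nat.pow_le_pow_left (Finite.one_lt_card (α := M)) c

variable {M' P : Type*} [AddCommGroup M'] [AddCommGroup P] (e : M →+ M' →+ P)

/-- **Read-off, index `c₁ + c₂`:** for `x` vanishing below `c₁` and `y` vanishing below `c₂`,
`C_{c₁+c₂}(x, y) = e(x_{c₁}, y_{c₂})`. [cite: MazurRubin2004, §1.3 and §5.3] -/
theorem convCoeff_add_eq_of_forall_lt {c₁ c₂ : ℕ} (h : c₁ + c₂ < J) (x : Fin J → M) (y : Fin J → M')
    (hx : ∀ i : Fin J, (i : ℕ) < c₁ → x i = 0) (hy : ∀ i : Fin J, (i : ℕ) < c₂ → y i = 0) :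
    convCoeff e J (c₁ + c₂) x y = e (x ⟨c₁, by omega⟩) (y ⟨c₂, by omega⟩) := by
  rw [convCoeff_def, Finset.sum_eq_single c₁]
  · rw [coeffFun_of_lt x (by omega), coeffFun_of_lt y (by omega)]
    congr 2; ext; simp
  · intro a ha hne
    rw [Finset.mem_range] at ha
    rcases lt_or_gt_of_ne hne with hlt | hgt
    · rw [coeffFun_of_lt x (by omega), hx _ hlt, map_zero, AddMonoidHom.zero_apply]
    · rw [coeffFun_of_lt y (by omega), hy _ (by simp only; omega), map_zero]
  · intro h; exact absurd (Finset.mem_range.mpr (by omega)) h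

/-- **Read-off, index `c₁ + c₂ + 1`:** for `x` vanishing below `c₁` and `y` vanishing below `c₂`,
`C_{c₁+c₂+1}(x, y) = e(x_{c₁}, y_{c₂+1}) + e(x_{c₁+1}, y_{c₂})`. [cite: MazurRubin2004, §1.3 and §5.3] -/
theorem convCoeff_add_succ_eq_of_forall_lt {c₁ c₂ : ℕ} (h : c₁ + c₂ + 1 < J) (x : Fin J → M)
    (y : Fin J → M') (hx : ∀ i : Fin J, (i : ℕ) < c₁ → x i = 0)
    (hy : ∀ i : Fin J, (i : ℕ) < c₂ → y i = 0) :
    convCoeff e J (c₁ + c₂ + 1) x y =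
      e (x ⟨c₁, by omega⟩) (y ⟨c₂ + 1, by omega⟩) + e (x ⟨c₁ + 1, by omega⟩) (y ⟨c₂, by omega⟩) := by
  rw [convCoeff_def, Finset.sum_eq_add_of_mem c₁ (c₁ + 1) (Finset.mem_range.mpr (by omega))
    (Finset.mem_range.mpr (by omega)) (by omega)]
  · rw [coeffFun_of_lt x (by omega), coeffFun_of_lt y (by omega), coeffFun_of_lt x (by omega),
      coeffFun_of_lt y (by omega)]
    congr 3 <;> ext <;> simp only <;> omega
  · intro a ha hne
    rw [Finset.mem_range] at ha
    rcases lt_or_ge a c₁ with hlt | hge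
    · rw [coeffFun_of_lt x (by omega), hx _ hlt, map_zero, AddMonoidHom.zero_apply]
    · have hgt : c₁ + 1 < a := by omega
      rw [coeffFun_of_lt y (by omega), hy _ (by simp only; omega), map_zero]

end Algebra

/-! ## §2 The index of the value group on a smaller subgroup -/

section ValueIndex

universe u v

variable {R : Type u} [Ring R] [TopologicalSpace R] {G : Type v} [Group G] [TopologicalSpace G]
  {X : TopRep.{v} R G}

/-- **`[φ(H) : φ(H')] ∣ [H : H']`**: if `φ(H) = X` (all of it) for a normal-enough subgroup `H` acting
trivially, then for `H' ≤ H` the index of the value group `φ(H')` in `X` divides `[H : H']` (`φ|_H` is a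
homomorphism onto `X`). [cite: Serre1972, §2.4 Prop. 15 and §2.6 (shape)] [folklore] -/
theorem index_valueSubgroup_dvd_relIndex (φ : contOneCocycles X) (H H' : Subgroup G) (hle : H' ≤ H)
    (hX : ∀ τ ∈ H, ∀ x : X, X.ρ τ x = x) (htop : contOneCocycles.valueSubgroup φ H hX = ⊤) :
    (contOneCocycles.valueSubgroup φ H' (fun τ hτ => hX τ (hle hτ))).index ∣ H'.relIndex H := by
  let f : H →* Multiplicative X :=
    { toFun := fun h => Multiplicative.ofAdd (φ.1 h)
      map_one' := by rw [Subgroup.coe_one, contOneCocycles.apply_one]; rfl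
      map_mul' := fun a b => by
        rw [Subgroup.coe_mul, contOneCocycles.apply_mul_of_fixed φ (hX a a.2)]; rfl }
  have hf : Function.Surjective f := by
    intro x
    have hx : Multiplicative.toAdd x ∈ contOneCocycles.valueSubgroup φ H hX := by
      rw [htop]; exact AddSubgroup.mem_top _
    obtain ⟨τ, hτ, hτx⟩ := hx
    exact ⟨⟨τ, hτ⟩, by simp [f, hτx]⟩
  have hmap : (H'.subgroupOf H).map f =
      AddSubgroup.toSubgroup (contOneCocycles.valueSubgroup φ H' (fun τ hτ => hX τ (hle hτ))) := by
    ext x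
    simp only [Subgroup.mem_map, Subgroup.mem_subgroupOf, Multiplicative.mem_toSubgroup,
      contOneCocycles.mem_valueSubgroup_iff]
    constructor
    · rintro ⟨h, hh, rfl⟩
      exact ⟨h, hh, by simp [f]⟩
    · rintro ⟨τ, hτ, hτx⟩
      exact ⟨⟨τ, hle hτ⟩, hτ, by simp [f, hτx]⟩
  rw [← AddSubgroup.index_toSubgroup, ← hmap]
  exact Subgroup.index_map_dvd _ hf

end ValueIndex

end Summit.BirchSwinnertonDyer.BirchSwinnertonDyer.Theorems.OneSidedTwistSqueezeX9KatoDivisibilityX9DefectLevels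

end
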